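import Summits.HodgeConjecture.CorCM.OcticWeilMultiFrameTransfer
import Summits.HodgeConjecture.CorCM.Census.OcticWeilMultiExtraction
import Summits.HodgeConjecture.CorCM.OcticWeil13PairEightfoldParts
import HarnessLib

/-!
# COR-CM — any number `r` of CM types over one octic CM field: the EIGHTFOLD part `{(m,a,+)} ⊔ {(m',a,−)}` of a weight of any
# product of copies of `E, B₁, …, B_r` has an algebraic line, GIVEN the sixfold parts of slots `m, m'` of the product with FOUR MORE
# CURVES (push-pull)

Cell `pub-hodgecm2` (COR-CM), seat b30 gen 25 (2026-08-23); count-neutral own lane OCTIC-MULTI (geometry half).  Theorems + one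
bookkeeping definition (`extO₄`, four fresh curve slots in front of an `(r+1)`-atom slot map); no named fact, no `sorry`.  The slot-generic
twin of gen 21's `CorCM/OcticWeil13PairEightfoldParts.lean` (same proof; its `succ₄_injective`, `eq_of_not_mem_range_succ₄`,
`not_mem_range_succ₄`, `decide_tauSign_eq`, `exists_eq_tauSign`, `tauSign_not_ne` BY NAME), a consumer of the cell's push-forward
extraction lemma `CMWeights.weightClassesAlg_le_algebraicClasses_of_pushforward` (`CorCM/CMWeightPushforwardExtraction.lean`).

THE ARGUMENT.  Let `X = ⨁_j A(κ j)` and let `G` be an eightfold part of a weight of `X`: one point over each label `(m, a, +)` (the four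
embeddings over `τ` on copies of `B_m`) and one over each `(m', a, −)` (over `τ̄`, on copies of `B_{m'}`) — the Weil weight of the
eightfold `B_m × B̄_{m'}` (`k`-signature `(4,4)`), `E`-free and therefore NOT a disjoint union of sixfold parts and pairs.  Put four
curves in front: `X⁺ = E ⊞ E ⊞ E ⊞ E ⊞ X = ⨁_l A(extO₄ κ l)`, `X` being the coordinate sub-product `e₄ j = j + 4`.  On `X⁺`, with
`T = {(0,τ), (1,τ), (2,τ̄), (3,τ̄)}`, `σ_{e₄} G ⊔ T = (σ G₀ ⊔ {(0,τ),(1,τ)}) ⊔ (σ G₁ ⊔ {(2,τ̄),(3,τ̄)})` is a disjoint union of a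
SIXFOLD part of slot `m`, sign `+` and a SIXFOLD part of slot `m'`, sign `−` (hypothesis `hsix`: their lines are algebraic — discharged
downstream from Markman's sixfold theorem for `(1,3)`-slots), and the complementary weight `T' = {(0,τ̄), (2,τ)} ⊔ {(1,τ̄), (3,τ)}` is
a disjoint union of two conjugate PAIRS of curve coordinates (divisor lines, `weightClassesAlg_le_algebraicClasses_of_isPairPartO`).
The push-forward extraction lemma then gives the line of `G` on `X` (codimension `4`).

* §1 `extO₄ κ = (0, 0, 0, 0, κ)` (`Fin.cons`, so that `extO₄ κ (j+4)` is DEFINITIONALLY `κ j`);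
* §2 **`weightClassesAlg_le_algebraicClasses_of_isEightPartO`** — THE LEMMA.
HONEST FRAMING: nothing about the Hodge conjecture is concluded in this file; `HC_CM` is not asserted.
[cite: Schoen1998HodgeWeilAddendum, §10] [cite: Milne2020HodgeClassesAV, 1.2 (a) and Thm. 1] [cite: MoonenZarhin1995Duke, Thm. 2.4]
[cite: Gordon1999HodgeAVSurvey, 9.2.2]

## References
* [Schoen1998HodgeWeilAddendum] C. Schoen, Compositio Math. 114 (1998), §10.  [Milne2020HodgeClassesAV] J. S. Milne,
  arXiv:2010.08857, 1.2 (a), Thm. 1.  [MoonenZarhin1995Duke] B. Moonen, Yu. Zarhin, Duke Math. J. 77 (1995), Thm. 2.4.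
  [Gordon1999HodgeAVSurvey] B. B. Gordon, CRM Monogr. 10 (1999), 9.2.2.
-/

noncomputable section

open CategoryTheory CategoryTheory.Limits NumberField

namespace Summit.HodgeConjecture.CorCM.OcticWeilMulti

open Literature.AlgebraicGeometry Literature.AlgebraicGeometry.Motives Literature.AlgebraicGeometry.HodgeTheory
open Literature.AlgebraicGeometry.ComplexMultiplication (IsCMTypeRealisation)
open Literature.AlgebraicGeometry.Pohlmann1968
open Literature.NumberTheory.ComplexMultiplication
open Summit.HodgeConjecture.CorCM.Census.OcticWeilMulti (PtO cjO cjO_inl IsPairPartO IsFourPartO IsSixPartO IsEightPartO)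
open Summit.HodgeConjecture.CorCM.DecicWeil23Multi (multiSlots)
open Summit.HodgeConjecture.CorCM.OcticWeil13Pair (succ₄_injective eq_of_not_mem_range_succ₄ not_mem_range_succ₄
  decide_tauSign_eq exists_eq_tauSign tauSign_not_ne)
open Summit.HodgeConjecture.CorCM.CMWeights (weightClassesAlg_le_algebraicClasses_of_pushforward sigma_map_injective)
open Summit.HodgeConjecture.CorCM.PairWeights (weightClassesAlg_union_le_algebraicClasses)

open scoped Classical

/-! ## §1 Four fresh curve slots in front -/

/-- **Four fresh curve slots in front of a slot map** (`r + 1` atoms): `extO₄ κ = (0, 0, 0, 0, κ)` as an iterated `Fin.cons`, so that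
`extO₄ κ j.succ.succ.succ.succ` is DEFINITIONALLY `κ j` and `extO₄ κ 0, …, extO₄ κ 3` are DEFINITIONALLY the curve slot `0` (the
`(r+1)`-atom twin of gen 21's `OcticWeil13Pair.ext₄`). [folklore] -/
def extO₄ {r N : ℕ} (κ : Fin N → Fin (r + 1)) : Fin (N + 4) → Fin (r + 1) :=
  Fin.cons 0 (Fin.cons 0 (Fin.cons 0 (Fin.cons 0 κ : Fin (N + 1) → Fin (r + 1)) : Fin (N + 2) → Fin (r + 1)) :
    Fin (N + 3) → Fin (r + 1))

/-- The embedding of the old slots: `e₄ j = j + 4`. [folklore] -/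
theorem extO₄_succ {r N : ℕ} (κ : Fin N → Fin (r + 1)) (j : Fin N) : extO₄ κ j.succ.succ.succ.succ = κ j := rfl

section Eightfold

variable {I : Type} {r : ℕ} {Kf : I → Type} [∀ i, Field (Kf i)] [∀ i, NumberField (Kf i)] [∀ i, IsCMField (Kf i)]
  {i₀ i₁ : I} {N : ℕ} (κ : Fin N → Fin (r + 1)) {e : (Kf i₁ →+* ℂ) ≃ Fin 4 × Bool} {τ : Kf i₀ →+* ℂ}
  (hττ : ComplexEmbedding.conjugate τ ≠ τ) (hk : ∀ σ : Kf i₀ →+* ℂ, σ = τ ∨ σ = ComplexEmbedding.conjugate τ)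
  (he_conj : ∀ s : Kf i₁ →+* ℂ, e (ComplexEmbedding.conjugate s) = ((e s).1, !(e s).2))
  {A : Fin (r + 1) → AbelianVariety ℂ} {Φ : ∀ j : Fin (r + 1), CMType (Kf (multiSlots r i₀ i₁ j))}
  {ι : ∀ j, 𝓞 (Kf (multiSlots r i₀ i₁ j)) →+* End (A j)}
  {θ : ∀ j, Kf (multiSlots r i₀ i₁ j) →+* Module.End ℂ (complexBetti (A j).X 1)}
  (hA : ∀ j, IsCMTypeRealisation (Φ j) (A j) (ι j) (θ j))

/-! ## §2 The eightfold part has an algebraic line, given the sixfold parts of `X⁺` -/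

include hττ hk he_conj hA in
/-- **THE EIGHTFOLD PART LEMMA.**  Let `X = ⨁_j A(κ j)` be a product of copies of `E, B₁, …, B_r` and `G` an eightfold part of a weight of
`X` (one point over each `(m, a, +)` and each `(m', a, −)`).  IF on `X⁺ = E⁴ × X = ⨁_l A(extO₄ κ l)` every sixfold part of slot `m` or
`m'` has an algebraic line (`hsix`), THEN the line of `G` on `X` is algebraic (codimension `4`): push-pull through the four fresh curves
(module docstring; `CMWeights.weightClassesAlg_le_algebraicClasses_of_pushforward`).
[cite: Schoen1998HodgeWeilAddendum, §10] [cite: Milne2020HodgeClassesAV, 1.2 (a) and Thm. 1] [cite: MoonenZarhin1995Duke, Thm. 2.4] -/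
theorem weightClassesAlg_le_algebraicClasses_of_isEightPartO {m m' : Fin r}
    (hsix : ∀ (m₀ : Fin r) (c : Bool) (G' : Finset ((l : Fin (N + 4)) × (Kf (multiSlots r i₀ i₁ (extO₄ κ l)) →+* ℂ))),
      (m₀ = m ∨ m₀ = m') → IsSixPartO (fun x => toPtO e τ ((Sigma.map (extO₄ κ) (fun _ => id) :
        ((l : Fin (N + 4)) × (Kf (multiSlots r i₀ i₁ (extO₄ κ l)) →+* ℂ)) → ((l : Fin (r + 1)) × (Kf (multiSlots r i₀ i₁ l) →+* ℂ))) x))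
          m₀ c G' →
        weightClassesAlg (fun l => A (extO₄ κ l)) (fun l => ι (extO₄ κ l)) (2 * 3) G' ≤
          algebraicClasses (⨁ fun l => A (extO₄ κ l)).X 3)
    {G : Finset ((j : Fin N) × (Kf (multiSlots r i₀ i₁ (κ j)) →+* ℂ))}
    (hG : IsEightPartO (fun x => toPtO e τ ((Sigma.map κ (fun _ => id) :
      ((j : Fin N) × (Kf (multiSlots r i₀ i₁ (κ j)) →+* ℂ)) → ((l : Fin (r + 1)) × (Kf (multiSlots r i₀ i₁ l) →+* ℂ))) x)) m m' G) :
    G.card = 2 * 4 ∧ weightClassesAlg (fun j => A (κ j)) (fun j => ι (κ j)) (2 * 4) G ≤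
      algebraicClasses (⨁ fun j => A (κ j)).X 4 := by
  have hGcard : G.card = 2 * 4 := by rw [hG.1]
  refine ⟨hGcard, ?_⟩
  -- ### notation: the two index sets, the model maps, the embedding `e₄`
  let IX := (j : Fin N) × (Kf (multiSlots r i₀ i₁ (κ j)) →+* ℂ)
  let IP := (l : Fin (N + 4)) × (Kf (multiSlots r i₀ i₁ (extO₄ κ l)) →+* ℂ)
  let v : IX → PtO r := fun x => toPtO e τ ((Sigma.map κ (fun _ => id) :
    IX → ((l : Fin (r + 1)) × (Kf (multiSlots r i₀ i₁ l) →+* ℂ))) x)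
  let vP : IP → PtO r := fun x => toPtO e τ ((Sigma.map (extO₄ κ) (fun _ => id) :
    IP → ((l : Fin (r + 1)) × (Kf (multiSlots r i₀ i₁ l) →+* ℂ))) x)
  let e₄ : Fin N → Fin (N + 4) := fun j => j.succ.succ.succ.succ
  have he₄ : Function.Injective e₄ := succ₄_injective
  let σ₄ : IX ↪ IP := ⟨_, sigma_map_injective (K := fun l => Kf (multiSlots r i₀ i₁ (extO₄ κ l))) e₄ he₄⟩
  have hvσ : ∀ x : IX, vP (σ₄ x) = v x := fun x => rfl
  have hσfst : ∀ x : IX, 4 ≤ ((σ₄ x).1 : ℕ) := fun x => by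
    change 4 ≤ ((x.1.succ.succ.succ.succ : Fin (N + 4)) : ℕ)
    simp only [Fin.val_succ]; omega
  have hAP : ∀ l, IsCMTypeRealisation (Φ (extO₄ κ l)) (A (extO₄ κ l)) (ι (extO₄ κ l)) (θ (extO₄ κ l)) :=
    fun l => hA (extO₄ κ l)
  -- ### the fresh curve coordinates
  let τs : Bool → (Kf i₀ →+* ℂ) := fun c => if c then τ else ComplexEmbedding.conjugate τ
  have hτs : ∀ c, decide (τs c = τ) = c := fun c => decide_tauSign_eq hττ c
  have hτs_ne : ∀ c, τs (!c) ≠ τs c := fun c => tauSign_not_ne hττ c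
  let p0 : Bool → IP := fun c => ⟨0, τs c⟩
  let p1 : Bool → IP := fun c => ⟨1, τs c⟩
  let p2 : Bool → IP := fun c => ⟨2, τs c⟩
  let p3 : Bool → IP := fun c => ⟨3, τs c⟩
  have hv0 : ∀ c, vP (p0 c) = Sum.inl c := fun c => by
    change toPtO (r := r) e τ ⟨0, τs c⟩ = _; rw [toPtO_zero, hτs]
  have hv1 : ∀ c, vP (p1 c) = Sum.inl c := fun c => by
    change toPtO (r := r) e τ ⟨0, τs c⟩ = _; rw [toPtO_zero, hτs]
  have hv2 : ∀ c, vP (p2 c) = Sum.inl c := fun c => by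
    change toPtO (r := r) e τ ⟨0, τs c⟩ = _; rw [toPtO_zero, hτs]
  have hv3 : ∀ c, vP (p3 c) = Sum.inl c := fun c => by
    change toPtO (r := r) e τ ⟨0, τs c⟩ = _; rw [toPtO_zero, hτs]
  have hfst0 : ∀ c, ((p0 c).1 : ℕ) = 0 := fun c => rfl
  have hfst1 : ∀ c, ((p1 c).1 : ℕ) = 1 := fun c => rfl
  have hfst2 : ∀ c, ((p2 c).1 : ℕ) = 2 := fun c => rfl
  have hfst3 : ∀ c, ((p3 c).1 : ℕ) = 3 := fun c => rfl
  -- every coordinate of a fresh slot is one of the eight points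
  have hfresh : ∀ x : IP, x.1 ∉ Set.range e₄ → ∃ c, x = p0 c ∨ x = p1 c ∨ x = p2 c ∨ x = p3 c := by
    rintro ⟨l, σ⟩ hl
    rcases eq_of_not_mem_range_succ₄ hl with rfl | rfl | rfl | rfl
    · obtain ⟨c, hc⟩ := exists_eq_tauSign hk σ; exact ⟨c, Or.inl (by rw [hc])⟩
    · obtain ⟨c, hc⟩ := exists_eq_tauSign hk σ; exact ⟨c, Or.inr (Or.inl (by rw [hc]))⟩
    · obtain ⟨c, hc⟩ := exists_eq_tauSign hk σ; exact ⟨c, Or.inr (Or.inr (Or.inl (by rw [hc])))⟩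
    · obtain ⟨c, hc⟩ := exists_eq_tauSign hk σ; exact ⟨c, Or.inr (Or.inr (Or.inr (by rw [hc])))⟩
  -- ### the weights `T = {p0 b, p1 b} ⊔ {p2 ¬b, p3 ¬b}` and `T' = {p0 ¬b, p2 b} ⊔ {p1 ¬b, p3 b}` (`b = true`)
  let b : Bool := true
  set T₁ : Finset IP := {p0 b, p1 b} with hT₁
  set T₂ : Finset IP := {p2 (!b), p3 (!b)} with hT₂
  set P₁ : Finset IP := {p0 (!b), p2 b} with hP₁
  set P₂ : Finset IP := {p1 (!b), p3 b} with hP₂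
  have hne01 : ∀ c c', p0 c ≠ p1 c' := fun c c' h => by have := congrArg (fun x : IP => (x.1 : ℕ)) h; simp [hfst0, hfst1] at this
  have hne02 : ∀ c c', p0 c ≠ p2 c' := fun c c' h => by have := congrArg (fun x : IP => (x.1 : ℕ)) h; simp [hfst0, hfst2] at this
  have hne03 : ∀ c c', p0 c ≠ p3 c' := fun c c' h => by have := congrArg (fun x : IP => (x.1 : ℕ)) h; simp [hfst0, hfst3] at this
  have hne12 : ∀ c c', p1 c ≠ p2 c' := fun c c' h => by have := congrArg (fun x : IP => (x.1 : ℕ)) h; simp [hfst1, hfst2] at this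
  have hne13 : ∀ c c', p1 c ≠ p3 c' := fun c c' h => by have := congrArg (fun x : IP => (x.1 : ℕ)) h; simp [hfst1, hfst3] at this
  have hne23 : ∀ c c', p2 c ≠ p3 c' := fun c c' h => by have := congrArg (fun x : IP => (x.1 : ℕ)) h; simp [hfst2, hfst3] at this
  have hne00 : p0 (!b) ≠ p0 b := fun h => hτs_ne b (eq_of_heq (Sigma.mk.inj_iff.1 h).2)
  have hne11 : p1 (!b) ≠ p1 b := fun h => hτs_ne b (eq_of_heq (Sigma.mk.inj_iff.1 h).2)
  have hne22 : p2 (!b) ≠ p2 b := fun h => hτs_ne b (eq_of_heq (Sigma.mk.inj_iff.1 h).2)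
  have hne33 : p3 (!b) ≠ p3 b := fun h => hτs_ne b (eq_of_heq (Sigma.mk.inj_iff.1 h).2)
  have hT₁card : T₁.card = 2 := Finset.card_pair (hne01 b b)
  have hT₂card : T₂.card = 2 := Finset.card_pair (hne23 (!b) (!b))
  have hP₁card : P₁.card = 2 := Finset.card_pair (hne02 (!b) b)
  have hP₂card : P₂.card = 2 := Finset.card_pair (hne13 (!b) b)
  have hT₁₂ : Disjoint T₁ T₂ := by
    rw [hT₁, hT₂, Finset.disjoint_left]
    intro x hx hx'
    simp only [Finset.mem_insert, Finset.mem_singleton] at hx hx'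
    rcases hx with rfl | rfl <;> rcases hx' with h | h
    exacts [hne02 _ _ h, hne03 _ _ h, hne12 _ _ h, hne13 _ _ h]
  have hP₁₂ : Disjoint P₁ P₂ := by
    rw [hP₁, hP₂, Finset.disjoint_left]
    intro x hx hx'
    simp only [Finset.mem_insert, Finset.mem_singleton] at hx hx'
    rcases hx with rfl | rfl <;> rcases hx' with h | h
    exacts [hne01 _ _ h, hne03 _ _ h, (hne12 _ _ h.symm).elim, hne23 _ _ h]
  set T : Finset IP := T₁ ∪ T₂ with hT
  set T' : Finset IP := P₁ ∪ P₂ with hT'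
  have hTcard : T.card = 2 * 2 := by rw [hT, Finset.card_union_of_disjoint hT₁₂, hT₁card, hT₂card]
  have hT'card : T'.card = 2 * 2 := by rw [hT', Finset.card_union_of_disjoint hP₁₂, hP₁card, hP₂card]
  have hmemT : ∀ x, x ∈ T ↔ x = p0 b ∨ x = p1 b ∨ x = p2 (!b) ∨ x = p3 (!b) := fun x => by
    simp only [hT, hT₁, hT₂, Finset.mem_union, Finset.mem_insert, Finset.mem_singleton, or_assoc]
  have hmemT' : ∀ x, x ∈ T' ↔ x = p0 (!b) ∨ x = p2 b ∨ x = p1 (!b) ∨ x = p3 b := fun x => by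
    simp only [hT', hP₁, hP₂, Finset.mem_union, Finset.mem_insert, Finset.mem_singleton, or_assoc]
  have hTT' : Disjoint T T' := by
    rw [Finset.disjoint_left]
    intro x hx hx'
    rw [hmemT] at hx
    rw [hmemT'] at hx'
    rcases hx with rfl | rfl | rfl | rfl <;> rcases hx' with h | h | h | h
    exacts [hne00 h.symm, hne02 _ _ h, hne01 _ _ h, hne03 _ _ h, (hne01 _ _ h.symm).elim, hne12 _ _ h, hne11 h.symm,
      hne13 _ _ h, (hne02 _ _ h.symm).elim, hne22 (h ▸ rfl) , (hne12 _ _ h.symm).elim, hne23 _ _ h,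
      (hne03 _ _ h.symm).elim, (hne23 _ _ h.symm).elim, (hne13 _ _ h.symm).elim, hne33 (h ▸ rfl)]
  -- `T ⊔ T'` = all coordinates off the old slots
  have hfreshT : ∀ x : IP, (x ∈ T ∨ x ∈ T') → x.1 ∉ Set.range e₄ := by
    intro x hx
    apply not_mem_range_succ₄
    rcases hx with hx | hx
    · rw [hmemT] at hx
      rcases hx with rfl | rfl | rfl | rfl
      · rw [hfst0]; norm_num
      · rw [hfst1]; norm_num
      · rw [hfst2]; norm_num
      · rw [hfst3]; norm_num
    · rw [hmemT'] at hx
      rcases hx with rfl | rfl | rfl | rfl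
      · rw [hfst0]; norm_num
      · rw [hfst2]; norm_num
      · rw [hfst1]; norm_num
      · rw [hfst3]; norm_num
  have hcov : ∀ x : IP, (x ∈ T ∨ x ∈ T') ↔ x.1 ∉ Set.range e₄ := by
    intro x
    refine ⟨hfreshT x, fun hx => ?_⟩
    obtain ⟨c, hc⟩ := hfresh x hx
    rw [hmemT, hmemT']
    by_cases hcb : c = b
    · subst hcb
      rcases hc with h | h | h | h
      · exact Or.inl (Or.inl h)
      · exact Or.inl (Or.inr (Or.inl h))
      · exact Or.inr (Or.inr (Or.inl h))
      · exact Or.inr (Or.inr (Or.inr (Or.inr h)))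
    · have hcb' : c = !b := by cases c <;> simp [b] at hcb ⊢
      subst hcb'
      rcases hc with h | h | h | h
      · exact Or.inr (Or.inl h)
      · exact Or.inr (Or.inr (Or.inr (Or.inl h)))
      · exact Or.inl (Or.inr (Or.inr (Or.inl h)))
      · exact Or.inl (Or.inr (Or.inr (Or.inr h)))
  -- ### `T'` is two conjugate pairs of curve coordinates: algebraic
  have hpair : ∀ (Q : Finset IP) (x y : IP), Q = {x, y} → x ≠ y → vP x = Sum.inl (!b) → vP y = Sum.inl b →
      Q.card = 2 * 1 ∧ weightClassesAlg (fun l => A (extO₄ κ l)) (fun l => ι (extO₄ κ l)) (2 * 1) Q ≤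
        algebraicClasses (⨁ fun l => A (extO₄ κ l)).X 1 := by
    rintro Q x y rfl hxy hx hy
    refine weightClassesAlg_le_algebraicClasses_of_isPairPartO (extO₄ κ) hττ hk he_conj hA ⟨Sum.inl (!b),
      Finset.card_pair hxy, ?_, ?_⟩
    · intro z hz z' hz' h
      simp only [Finset.coe_insert, Finset.coe_singleton, Set.mem_insert_iff, Set.mem_singleton_iff] at hz hz'
      rcases hz with rfl | rfl <;> rcases hz' with rfl | rfl
      · rfl
      · exact absurd (hx.symm.trans (h.trans hy)) (by simp [b])
      · exact absurd (hy.symm.trans (h.trans hx)) (by simp [b])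
      · rfl
    · rw [Finset.image_insert, Finset.image_singleton, cjO_inl, Bool.not_not]
      change ({vP x, vP y} : Finset (PtO r)) = _
      rw [hx, hy]
  have halg₂ : weightClassesAlg (fun l => A (extO₄ κ l)) (fun l => ι (extO₄ κ l)) (2 * 2) T' ≤
      algebraicClasses (⨁ fun l => A (extO₄ κ l)).X 2 := by
    obtain ⟨h1c, h1a⟩ := hpair P₁ (p0 (!b)) (p2 b) hP₁ (hne02 _ _) (hv0 _) (hv2 _)
    obtain ⟨h2c, h2a⟩ := hpair P₂ (p1 (!b)) (p3 b) hP₂ (hne13 _ _) (hv1 _) (hv3 _)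
    have h := weightClassesAlg_union_le_algebraicClasses hAP (a := 1) (b := 1) (p := 2) rfl h1c h2c hP₁₂ h1a h2a
    rwa [Finset.disjUnion_eq_union] at h
  -- ### `σ G ⊔ T` is two sixfold parts: algebraic
  obtain ⟨G₀, G₁, hG₀₁, hGU, hW₀, hW₁⟩ := hG.exists_split
  have hsixpart : ∀ (m₀ : Fin r) (c : Bool) (W : Finset IX) (x y : IP), IsFourPartO v m₀ c W → x ≠ y →
      vP x = Sum.inl c → vP y = Sum.inl c → ((x.1 : ℕ) < 4) → ((y.1 : ℕ) < 4) →
      Disjoint (W.map σ₄) {x, y} ∧ IsSixPartO vP m₀ c (W.map σ₄ ∪ {x, y}) := by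
    intro m₀ c W x y hW hxy hx hy hx4 hy4
    have hdisj : Disjoint (W.map σ₄) {x, y} := by
      rw [Finset.disjoint_left]
      intro z hz hz'
      obtain ⟨w, -, rfl⟩ := Finset.mem_map.1 hz
      simp only [Finset.mem_insert, Finset.mem_singleton] at hz'
      have h4 := hσfst w
      rcases hz' with h | h
      · rw [h] at h4; omega
      · rw [h] at h4; omega
    refine ⟨hdisj, ?_, ?_, fun a => ?_⟩
    · rw [Finset.card_union_of_disjoint hdisj, Finset.card_map, hW.1, Finset.card_pair hxy]
    · have hF : ∀ z ∈ W.map σ₄, ¬ vP z = Sum.inl c := fun z hz => by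
        obtain ⟨w, hw, rfl⟩ := Finset.mem_map.1 hz
        obtain ⟨a, ha⟩ := hW.exists_eq_inr hw
        change vP (σ₄ w) ≠ _
        rw [hvσ, show v w = Sum.inr (m₀, (a, c)) from ha]
        exact Sum.inr_ne_inl
      have hT : ∀ z ∈ ({x, y} : Finset IP), vP z = Sum.inl c := fun z hz => by
        simp only [Finset.mem_insert, Finset.mem_singleton] at hz
        rcases hz with rfl | rfl
        exacts [hx, hy]
      rw [Finset.filter_union, Finset.filter_false_of_mem hF, Finset.empty_union, Finset.filter_true_of_mem hT,
        Finset.card_pair hxy]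
    · have hF : ∀ z ∈ ({x, y} : Finset IP), ¬ vP z = Sum.inr (m₀, (a, c)) := fun z hz => by
        simp only [Finset.mem_insert, Finset.mem_singleton] at hz
        rcases hz with rfl | rfl
        · rw [show vP _ = _ from hx]; exact Sum.inl_ne_inr
        · rw [show vP _ = _ from hy]; exact Sum.inl_ne_inr
      rw [Finset.filter_union, Finset.filter_false_of_mem hF, Finset.union_empty, Finset.filter_map, Finset.card_map,
        ← hW.2 a]
      exact congrArg Finset.card (Finset.filter_congr fun w _ => by rw [Function.comp_apply, hvσ])
  obtain ⟨hd₁, hS₁⟩ := hsixpart m b G₀ (p0 b) (p1 b) hW₀ (hne01 _ _) (hv0 _) (hv1 _) (by rw [hfst0]; norm_num)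
    (by rw [hfst1]; norm_num)
  obtain ⟨hd₂, hS₂⟩ := hsixpart m' (!b) G₁ (p2 (!b)) (p3 (!b)) hW₁ (hne23 _ _) (hv2 _) (hv3 _) (by rw [hfst2]; norm_num)
    (by rw [hfst3]; norm_num)
  have hS₁₂ : Disjoint (G₀.map σ₄ ∪ T₁) (G₁.map σ₄ ∪ T₂) := by
    rw [Finset.disjoint_union_left, Finset.disjoint_union_right, Finset.disjoint_union_right]
    refine ⟨⟨(Finset.disjoint_map σ₄).2 hG₀₁, ?_⟩, ?_, hT₁₂⟩
    · rw [Finset.disjoint_left]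
      intro z hz hz'
      obtain ⟨w, -, rfl⟩ := Finset.mem_map.1 hz
      have h4 := hσfst w
      rw [hT₂] at hz'
      simp only [Finset.mem_insert, Finset.mem_singleton] at hz'
      rcases hz' with h | h
      · rw [h, hfst2] at h4; omega
      · rw [h, hfst3] at h4; omega
    · rw [Finset.disjoint_left]
      intro z hz hz'
      obtain ⟨w, -, rfl⟩ := Finset.mem_map.1 hz'
      have h4 := hσfst w
      rw [hT₁] at hz
      simp only [Finset.mem_insert, Finset.mem_singleton] at hz
      rcases hz with h | h
      · rw [h, hfst0] at h4; omega
      · rw [h, hfst1] at h4; omega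
  have hunion : G.map σ₄ ∪ T = (G₀.map σ₄ ∪ T₁).disjUnion (G₁.map σ₄ ∪ T₂) hS₁₂ := by
    rw [Finset.disjUnion_eq_union, hGU, Finset.map_union, hT, Finset.union_union_union_comm]
  have halg₁ : weightClassesAlg (fun l => A (extO₄ κ l)) (fun l => ι (extO₄ κ l)) (2 * (4 + 2)) (G.map σ₄ ∪ T) ≤
      algebraicClasses (⨁ fun l => A (extO₄ κ l)).X (4 + 2) := by
    rw [hunion]
    exact weightClassesAlg_union_le_algebraicClasses hAP (a := 3) (b := 3) (p := 4 + 2) rfl hS₁.1 hS₂.1 hS₁₂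
      (hsix m b _ (Or.inl rfl) hS₁) (hsix m' (!b) _ (Or.inr rfl) hS₂)
  -- ### push-pull
  exact weightClassesAlg_le_algebraicClasses_of_pushforward (A := fun l => A (extO₄ κ l))
    (Φ := fun l => Φ (extO₄ κ l)) (ι := fun l => ι (extO₄ κ l)) (θ := fun l => θ (extO₄ κ l)) hAP e₄ he₄
    (p := 4) (q := 2) (r := 2) hGcard hTcard hT'card hTT' hcov halg₁ halg₂

end Eightfold

end Summit.HodgeConjecture.CorCM.OcticWeilMulti

end
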